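import Summits.AtomisticToContinuum.Crystallization.Theorems.PricedLinkCensusLocalToGlobalThomsonPotential

/-!
# The Newton field `‖y‖⁻⁸ y` of `ℝ⁸`: local integrability of `‖·‖⁻⁷`, the gradient of the regularised
# kernel, and `Δ f_t` as an approximate identity

Route `PricedLinkCensus`, crux `LocalToGlobal` (stmt-AtomisticToContinuum-14232), line
`flux-cell-joint-census`, support for the registered stub `stub_fccMirrorExact : NewtonShell8 → FccMirrorExact`
(`Theorems/PricedLinkCensusLocalToGlobalDefs`), second half (`fluxCell ≤ S₆`, the method of images).  The
candidate confined flux of the method of images is a lattice sum of SMEARED NEWTON FIELDS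
`z ↦ ⨍_{B(0,r)} E(z - w) dw`, `E(y) = (3/π⁴) ‖y‖⁻⁸ y = -(2π⁴)⁻¹ ∇‖y‖⁻⁶` (`pointField`), obtained as the limit
`t → 0` of the gradients of the regularised potentials `farPotential t ρ` of
`PricedLinkCensusLocalToGlobalThomsonPotential`.  This file supplies the kernel-level inputs:

* `pointField`, `‖E(y)‖ = (3/π⁴)‖y‖⁻⁷`; `‖·‖⁻⁷` is integrable on balls of `ℝ⁸`, `∫_{B(0,r)} ‖u‖⁻⁷ = (π⁴/3) r`,
  and `∫_{B(c,r)} ‖x - w‖⁻⁷ dw ≤ π⁴ r` uniformly in `x` (`setIntegral_inv_norm_sub_pow_seven_le`);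
* the gradient of the regularised kernel: `∇f_t(y) = 2 g_t′(‖y‖²) y`, `= -2π⁴ E(y)` for `‖y‖ > t`, and the
  bound `‖Df_t(y)‖ ≤ A ‖y‖⁻⁷` with `A` INDEPENDENT of `t` (scaling `f_t(y) = t⁻⁶ f₁(y/t)`; registered sub-goal
  `fccMirror_fderiv_newtonFar8_uniform`);
* `Δ f_t` is `-2π⁴` times an approximate identity: `∫ Δf_t(z - w) φ(z) dz → -2π⁴ φ(w)` as `t → 0⁺` for bounded
  continuous `φ`, with the uniform bound `M ∫|Δf₁|` (`tendsto_integral_laplacian_newtonFar8_mul`).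

References: D. Gilbarg, N. S. Trudinger, *Elliptic PDE of second order* (2001), §2.4, Lemma 4.1; E. H. Lieb,
M. Loss, *Analysis* (2001), Thm 6.21, §9.7; G. B. Folland, *Real Analysis* (1999), Cor. 2.51, Thm 8.15.
-/

noncomputable section

open MeasureTheory Set Filter Metric Topology InnerProductSpace Function
open scoped RealInnerProductSpace Laplacian

namespace Summit.AtomisticToContinuum.Crystallization.Theorems.PricedLinkCensusLocalToGlobal

/-! ### The point field -/

/-- THE NEWTON FIELD OF A UNIT POINT CHARGE IN `ℝ⁸`: `E(y) = (3/π⁴) ‖y‖⁻⁸ y = -(2π⁴)⁻¹ ∇ ‖y‖⁻⁶`. [folklore] -/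
def pointField (y : E8) : E8 := (3 / Real.pi ^ 4 * ‖y‖⁻¹ ^ 8) • y

/-- `‖E(y)‖ = (3/π⁴) ‖y‖⁻⁷`. [folklore] -/
theorem norm_pointField (y : E8) : ‖pointField y‖ = 3 / Real.pi ^ 4 * ‖y‖⁻¹ ^ 7 := by
  rw [pointField, norm_smul, Real.norm_eq_abs, abs_of_nonneg (by positivity)]
  by_cases hy : y = 0
  · simp [hy]
  · have h : ‖y‖ ≠ 0 := norm_ne_zero_iff.2 hy
    rw [show ‖y‖⁻¹ ^ 8 = ‖y‖⁻¹ ^ 7 * ‖y‖⁻¹ by ring, mul_assoc, mul_assoc, inv_mul_cancel₀ h, mul_one]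

/-- `E` is continuous off the origin. [folklore] -/
theorem continuousOn_pointField : ContinuousOn pointField {0}ᶜ := by
  refine ContinuousOn.smul (continuousOn_const.mul ((continuousOn_id.norm.inv₀ fun y hy => ?_).pow 8))
    continuousOn_id
  exact norm_ne_zero_iff.2 hy

/-- `E` is measurable. [folklore] -/
theorem measurable_pointField : Measurable pointField :=
  (measurable_const.mul (measurable_norm.inv.pow_const 8)).smul measurable_id

/-! ### Local integrability of `‖·‖⁻⁷` in `ℝ⁸` -/

/-- `‖·‖⁻⁷` is integrable on every ball `B(0, r)` of `ℝ⁸` (in polar coordinates the integrand is `s⁷ s⁻⁷ = 1`). [folklore] -/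
theorem integrableOn_inv_norm_pow_seven_ball (r : ℝ) : IntegrableOn (fun u : E8 => ‖u‖⁻¹ ^ 7) (ball 0 r) := by
  have h := (integrableOn_fun_norm_addHaar (volume : Measure E8) (f := fun y : ℝ => y⁻¹ ^ 7) (r := r)).2 ?_
  · exact h
  · rw [finrank_euclideanSpace_fin]
    refine ((continuous_const (y := (1 : ℝ))).integrableOn_Icc.mono_set Ioo_subset_Icc_self).congr_fun
      (fun y hy => ?_) measurableSet_Ioo
    have hy0 : (y : ℝ) ≠ 0 := ne_of_gt hy.1
    simp only [smul_eq_mul]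
    field_simp

/-- **`∫_{B(0,r)} ‖u‖⁻⁷ du = (π⁴/3) r`** in `ℝ⁸` (`= 8 · vol B₁ · r`, `vol B₁ = π⁴/24`). [cite: Folland1999, Cor. 2.51] -/
theorem setIntegral_inv_norm_pow_seven_ball {r : ℝ} (hr : 0 ≤ r) :
    ∫ u in ball (0 : E8) r, ‖u‖⁻¹ ^ 7 = Real.pi ^ 4 / 3 * r := by
  have hind : (ball (0 : E8) r).indicator (fun u : E8 => ‖u‖⁻¹ ^ 7) =
      fun u : E8 => (Iio r).indicator (fun s : ℝ => s⁻¹ ^ 7) ‖u‖ := by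
    funext u
    by_cases hu : ‖u‖ < r
    · simp [indicator, hu]
    · simp [indicator, hu]
  rw [← integral_indicator measurableSet_ball, hind,
    integral_fun_norm_addHaar (volume : Measure E8) (fun s : ℝ => (Iio r).indicator (fun s : ℝ => s⁻¹ ^ 7) s),
    finrank_euclideanSpace_fin, volume_real_ball_E8]
  have hinner : ∫ s in Ioi (0 : ℝ), s ^ (8 - 1) • (Iio r).indicator (fun s : ℝ => s⁻¹ ^ 7) s = r := by
    have h1 : EqOn (fun s : ℝ => s ^ (8 - 1) • (Iio r).indicator (fun s : ℝ => s⁻¹ ^ 7) s)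
        ((Iio r).indicator fun _ : ℝ => (1 : ℝ)) (Ioi 0) := by
      intro s hs
      have hs0 : (s : ℝ) ≠ 0 := ne_of_gt hs
      by_cases hsr : s < r
      · simp only [indicator, mem_Iio, hsr, if_true, smul_eq_mul]
        field_simp
      · simp [indicator, hsr]
    rw [setIntegral_congr_fun measurableSet_Ioi h1, setIntegral_indicator measurableSet_Iio,
      show Ioi (0 : ℝ) ∩ Iio r = Ioo 0 r from rfl, setIntegral_const, smul_eq_mul, mul_one, Real.volume_real_Ioo,
      sub_zero, max_eq_left hr]
  rw [hinner]
  simp only [nsmul_eq_mul, smul_eq_mul]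
  push_cast
  ring

/-- `‖·‖⁻⁷` is integrable on every ball of `ℝ⁸`. [folklore] -/
theorem integrableOn_inv_norm_pow_seven_ball' (a : E8) (r : ℝ) :
    IntegrableOn (fun u : E8 => ‖u‖⁻¹ ^ 7) (ball a r) :=
  (integrableOn_inv_norm_pow_seven_ball (‖a‖ + r)).mono_set (ball_subset_ball' (by rw [dist_zero_right, add_comm]))

/-- `w ↦ ‖x - w‖⁻⁷` is integrable on every ball of `ℝ⁸`. [folklore] -/
theorem integrableOn_inv_norm_sub_pow_seven (x c : E8) (r : ℝ) :
    IntegrableOn (fun w : E8 => ‖x - w‖⁻¹ ^ 7) (ball c r) := by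
  have hmp := Measure.measurePreserving_sub_left (volume : Measure E8) x
  have hemb : MeasurableEmbedding (fun w : E8 => x - w) := (MeasurableEquiv.subLeft x).measurableEmbedding
  have h := (hmp.integrableOn_comp_preimage hemb (f := fun u : E8 => ‖u‖⁻¹ ^ 7) (s := ball (x - c) r)).2
    (integrableOn_inv_norm_pow_seven_ball' (x - c) r)
  rwa [preimage_sub_left_ball] at h

/-- Change of variables: `∫_{B(c,r)} ‖x - w‖⁻⁷ dw = ∫_{B(x - c, r)} ‖u‖⁻⁷ du`. [folklore] -/
theorem setIntegral_inv_norm_sub_pow_seven_eq (x c : E8) (r : ℝ) :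
    ∫ w in ball c r, ‖x - w‖⁻¹ ^ 7 = ∫ u in ball (x - c) r, ‖u‖⁻¹ ^ 7 := by
  have hmp := Measure.measurePreserving_sub_left (volume : Measure E8) x
  have hemb : MeasurableEmbedding (fun w : E8 => x - w) := (MeasurableEquiv.subLeft x).measurableEmbedding
  rw [← preimage_sub_left_ball x c r]
  exact hmp.setIntegral_preimage_emb hemb (fun u : E8 => ‖u‖⁻¹ ^ 7) (ball (x - c) r)

/-- **Uniform bound**: `∫_{B(c,r)} ‖x - w‖⁻⁷ dw ≤ π⁴ r` for every `x` (near centres: `B(x - c, r) ⊆ B(0, 3r)` and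
`(π⁴/3)(3r) = π⁴ r`; far centres: the integrand is `≤ r⁻⁷` on a ball of volume `(π⁴/24) r⁸`). [folklore] -/
theorem setIntegral_inv_norm_sub_pow_seven_le (x c : E8) {r : ℝ} (hr : 0 ≤ r) :
    ∫ w in ball c r, ‖x - w‖⁻¹ ^ 7 ≤ Real.pi ^ 4 * r := by
  rcases hr.eq_or_lt with h0 | hr0
  · rw [← h0, ball_zero, Measure.restrict_empty, integral_zero_measure]; norm_num
  rw [setIntegral_inv_norm_sub_pow_seven_eq]
  rcases le_or_gt ‖x - c‖ (2 * r) with hxc | hxc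
  · have hsub : ball (x - c) r ⊆ ball (0 : E8) (3 * r) := ball_subset_ball' (by rw [dist_zero_right]; linarith)
    calc ∫ u in ball (x - c) r, ‖u‖⁻¹ ^ 7 ≤ ∫ u in ball (0 : E8) (3 * r), ‖u‖⁻¹ ^ 7 :=
          setIntegral_mono_set (integrableOn_inv_norm_pow_seven_ball _)
            (Eventually.of_forall fun u => by positivity) (Eventually.of_forall hsub)
      _ = Real.pi ^ 4 / 3 * (3 * r) := setIntegral_inv_norm_pow_seven_ball (by linarith)
      _ = Real.pi ^ 4 * r := by ring
  · have hbound : ∀ u ∈ ball (x - c) r, ‖u‖⁻¹ ^ 7 ≤ r⁻¹ ^ 7 := fun u hu => by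
      rw [mem_ball, dist_eq_norm] at hu
      have h1 : r ≤ ‖u‖ := by
        have := norm_sub_norm_le (x - c) u
        rw [show ‖x - c - u‖ = ‖u - (x - c)‖ from norm_sub_rev _ _] at this
        linarith
      exact pow_le_pow_left₀ (by positivity) (inv_anti₀ hr0 h1) 7
    calc ∫ u in ball (x - c) r, ‖u‖⁻¹ ^ 7 ≤ ∫ _ in ball (x - c) r, r⁻¹ ^ 7 :=
          setIntegral_mono_on (integrableOn_inv_norm_pow_seven_ball' _ _) (integrableOn_const measure_ball_lt_top.ne)
            measurableSet_ball hbound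
      _ = Real.pi ^ 4 / 24 * r ^ 8 * r⁻¹ ^ 7 := by rw [setIntegral_const, smul_eq_mul, volume_real_ball_E8' _ hr]
      _ = Real.pi ^ 4 / 24 * r := by field_simp
      _ ≤ Real.pi ^ 4 * r := by nlinarith [pow_pos Real.pi_pos 4]

/-- The shifted point field `w ↦ E(x - w)` is integrable on every ball. [folklore] -/
theorem integrableOn_pointField_sub (x c : E8) (r : ℝ) : IntegrableOn (fun w : E8 => pointField (x - w)) (ball c r) := by
  refine Integrable.mono' (g := fun w => 3 / Real.pi ^ 4 * ‖x - w‖⁻¹ ^ 7)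
    ((integrableOn_inv_norm_sub_pow_seven x c r).const_mul _)
    ((measurable_pointField.comp (measurable_const.sub measurable_id)).aestronglyMeasurable)
    (Eventually.of_forall fun w => ?_)
  rw [norm_pointField]

/-- `‖∫_{B(c,r)} E(x - w) dw‖ ≤ (3/π⁴) π⁴ r = 3r`. [folklore] -/
theorem norm_setIntegral_pointField_sub_le (x c : E8) {r : ℝ} (hr : 0 ≤ r) :
    ‖∫ w in ball c r, pointField (x - w)‖ ≤ 3 * r := by
  calc ‖∫ w in ball c r, pointField (x - w)‖ ≤ ∫ w in ball c r, ‖pointField (x - w)‖ := norm_integral_le_integral_norm _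
    _ = 3 / Real.pi ^ 4 * ∫ w in ball c r, ‖x - w‖⁻¹ ^ 7 := by
        rw [← integral_const_mul]
        exact integral_congr_ae (Eventually.of_forall fun w => norm_pointField _)
    _ ≤ 3 / Real.pi ^ 4 * (Real.pi ^ 4 * r) :=
        mul_le_mul_of_nonneg_left (setIntegral_inv_norm_sub_pow_seven_le x c hr) (by positivity)
    _ = 3 * r := by field_simp

/-! ### The gradient of the regularised kernel -/

section Kernel

variable {t : ℝ}

/-- `∇f_t(y) = 2 g_t′(‖y‖²) y`. [folklore] -/
theorem gradient_newtonFar8 (ht : 0 < t) (y : E8) : gradient (newtonFar8 t) y = (2 * farProfile8₁ t (‖y‖ ^ 2)) • y := by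
  rw [gradient, (hasFDerivAt_newtonFar8 ht y).fderiv, map_smul]
  congr 1
  refine ext_inner_right ℝ fun x => ?_
  rw [toDual_symm_apply, innerSL_apply_apply]

/-- **Far gradient**: `∇f_t(y) = -2π⁴ E(y)` for `‖y‖ > t` (there `f_t = ‖·‖⁻⁶` and `∇‖y‖⁻⁶ = -6‖y‖⁻⁸ y`). [folklore] -/
theorem gradient_newtonFar8_of_gt (ht : 0 < t) {y : E8} (hy : t < ‖y‖) :
    gradient (newtonFar8 t) y = -(2 * Real.pi ^ 4) • pointField y := by
  have hy0 : 0 < ‖y‖ := ht.trans hy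
  have hσ : t ^ 2 < ‖y‖ ^ 2 := by gcongr
  rw [gradient_newtonFar8 ht, farProfile8₁_eq ht hσ, pointField, smul_smul]
  congr 1
  have hπ : Real.pi ^ 4 ≠ 0 := by positivity
  rw [show ((‖y‖ ^ 2) ^ (-4 : ℤ) : ℝ) = ‖y‖⁻¹ ^ 8 by rw [zpow_neg, zpow_ofNat, ← pow_mul, inv_pow]]
  field_simp

/-- Scaling of the derivative: `Df_t(y) = t⁻⁶ Df₁(y/t) ∘ (t⁻¹ ·)`. [folklore] -/
theorem hasFDerivAt_newtonFar8_scale (ht : 0 < t) (y : E8) :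
    HasFDerivAt (newtonFar8 t)
      ((t ^ 6)⁻¹ • (fderiv ℝ (newtonFar8 1) (t⁻¹ • y)).comp (t⁻¹ • ContinuousLinearMap.id ℝ E8)) y := by
  rw [newtonFar8_eq_scale ht]
  have h1 : HasFDerivAt (fun z : E8 => t⁻¹ • z) (t⁻¹ • ContinuousLinearMap.id ℝ E8) y :=
    (hasFDerivAt_id (𝕜 := ℝ) y).const_smul t⁻¹
  have h2 : HasFDerivAt (newtonFar8 1) (fderiv ℝ (newtonFar8 1) (t⁻¹ • y)) (t⁻¹ • y) :=
    (hasFDerivAt_newtonFar8 one_pos _).differentiableAt.hasFDerivAt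
  exact (h2.comp y h1).const_smul ((t ^ 6)⁻¹)

/-- **Gradient bound, uniform in `t`**: `‖Df_t(y)‖ ≤ A ‖y‖⁻⁷` for all `t > 0`, `y`, with one constant `A ≥ 0`
(`Df₁` is bounded by `A(1 + ‖·‖)⁻⁷ ≤ A‖·‖⁻⁷` and `Df_t(y) = t⁻⁷ Df₁(y/t)`). [folklore] -/
theorem exists_norm_fderiv_newtonFar8_le_uniform :
    ∃ A : ℝ, 0 ≤ A ∧ ∀ t : ℝ, 0 < t → ∀ y : E8, ‖fderiv ℝ (newtonFar8 t) y‖ ≤ A * ‖y‖⁻¹ ^ 7 := by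
  obtain ⟨A, hA0, hA⟩ := exists_norm_fderiv_newtonFar8_le_weight one_pos
  -- `‖Df₁(y)‖ ≤ A ‖y‖⁻⁷` for all `y`
  have h1 : ∀ y : E8, ‖fderiv ℝ (newtonFar8 1) y‖ ≤ A * ‖y‖⁻¹ ^ 7 := fun y => by
    by_cases hy : y = 0
    · rw [norm_fderiv_newtonFar8 one_pos, hy, norm_zero, mul_zero, inv_zero, zero_pow (by norm_num), mul_zero]
    · refine (hA y).trans (mul_le_mul_of_nonneg_left (pow_le_pow_left₀ (by positivity) ?_ 7) hA0)
      exact inv_anti₀ (norm_pos_iff.2 hy) (by linarith [norm_nonneg y])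
  refine ⟨A, hA0, fun t ht y => ?_⟩
  rw [(hasFDerivAt_newtonFar8_scale ht y).fderiv, norm_smul, Real.norm_of_nonneg (by positivity)]
  have hcomp : ‖(fderiv ℝ (newtonFar8 1) (t⁻¹ • y)).comp (t⁻¹ • ContinuousLinearMap.id ℝ E8)‖ ≤
      A * ‖t⁻¹ • y‖⁻¹ ^ 7 * t⁻¹ := by
    refine (ContinuousLinearMap.opNorm_comp_le _ _).trans (mul_le_mul (h1 _) ?_ (norm_nonneg _) (by positivity))
    rw [norm_smul, Real.norm_of_nonneg (inv_nonneg.2 ht.le)]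
    exact mul_le_of_le_one_right (inv_nonneg.2 ht.le) ContinuousLinearMap.norm_id_le
  refine (mul_le_mul_of_nonneg_left hcomp (by positivity)).trans_eq ?_
  rw [norm_smul, Real.norm_of_nonneg (inv_nonneg.2 ht.le), mul_inv, inv_inv, mul_pow]
  field_simp

/-- **Registered sub-goal `fccMirror_fderiv_newtonFar8_uniform`** (line `flux-cell-joint-census`, support of
`stub_fccMirrorExact`): the `t`-uniform gradient bound of the regularised Newton kernel, binder form of
`exists_norm_fderiv_newtonFar8_le_uniform`. [folklore] -/
theorem fccMirror_fderiv_newtonFar8_uniform :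
    ∃ A : ℝ, 0 ≤ A ∧ ∀ t : ℝ, 0 < t → ∀ y : E8, ‖fderiv ℝ (newtonFar8 t) y‖ ≤ A * ‖y‖⁻¹ ^ 7 :=
  exists_norm_fderiv_newtonFar8_le_uniform

/-- The gradient has the norm of the derivative. [folklore] -/
theorem norm_gradient_eq (f : E8 → ℝ) (y : E8) : ‖gradient f y‖ = ‖fderiv ℝ f y‖ := by
  rw [gradient, LinearIsometryEquiv.norm_map]

/-- **`∇f_t + 2π⁴ E` lives in `B̄(0, t)` and is `O(‖y‖⁻⁷)` there**: with the constant `A` of the uniform bound,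
`‖∇f_t(y) + 2π⁴ E(y)‖ ≤ 𝟙[‖y‖ ≤ t] (A + 6) ‖y‖⁻⁷`. [folklore] -/
theorem norm_gradient_newtonFar8_add_le {A : ℝ} (hA : ∀ t : ℝ, 0 < t → ∀ y : E8, ‖fderiv ℝ (newtonFar8 t) y‖ ≤ A * ‖y‖⁻¹ ^ 7)
    (ht : 0 < t) (y : E8) :
    ‖gradient (newtonFar8 t) y + (2 * Real.pi ^ 4) • pointField y‖ ≤
      (closedBall (0 : E8) t).indicator (fun y => (A + 6) * ‖y‖⁻¹ ^ 7) y := by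
  by_cases hy : ‖y‖ ≤ t
  · rw [indicator_of_mem (mem_closedBall_zero_iff.2 hy)]
    calc ‖gradient (newtonFar8 t) y + (2 * Real.pi ^ 4) • pointField y‖
        ≤ ‖gradient (newtonFar8 t) y‖ + ‖(2 * Real.pi ^ 4) • pointField y‖ := norm_add_le _ _
      _ ≤ A * ‖y‖⁻¹ ^ 7 + 6 * ‖y‖⁻¹ ^ 7 := by
          refine add_le_add ?_ ?_
          · rw [norm_gradient_eq]; exact hA t ht y
          · rw [norm_smul, norm_pointField, Real.norm_of_nonneg (by positivity)]
            have hπ : Real.pi ^ 4 ≠ 0 := by positivity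
            exact le_of_eq (by field_simp; ring)
      _ = (A + 6) * ‖y‖⁻¹ ^ 7 := by ring
  · rw [indicator_of_notMem (fun h => hy (mem_closedBall_zero_iff.1 h)), gradient_newtonFar8_of_gt ht (not_le.1 hy),
      neg_smul, neg_add_cancel, norm_zero]

end Kernel

/-! ### `Δ f_t` as an approximate identity -/

section ApproxIdentity

variable {t : ℝ}

/-- Substitution: `∫ Δf_t(z - w) φ(z) dz = ∫ Δf₁(u) φ(w + t u) du` (`Δf_t(y) = t⁻⁸ Δf₁(y/t)`). [folklore] -/
theorem integral_laplacian_newtonFar8_sub_mul (ht : 0 < t) (φ : E8 → ℝ) (w : E8) :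
    ∫ z, (Δ (newtonFar8 t)) (z - w) * φ z = ∫ u, (Δ (newtonFar8 1)) u * φ (w + t • u) := by
  -- translate `z = y + w`
  have h1 : ∫ z, (Δ (newtonFar8 t)) (z - w) * φ z = ∫ y, (Δ (newtonFar8 t)) y * φ (y + w) := by
    have h := integral_add_right_eq_self (μ := (volume : Measure E8)) (fun z => (Δ (newtonFar8 t)) (z - w) * φ z) w
    simp only [add_sub_cancel_right] at h
    exact h.symm
  -- dilate `y = t u`
  have h2 : ∫ y, (Δ (newtonFar8 t)) y * φ (y + w) = ∫ y, (t ^ 8)⁻¹ * ((Δ (newtonFar8 1)) (t⁻¹ • y) * φ (y + w)) :=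
    integral_congr_ae (Eventually.of_forall fun y => by simp only; rw [laplacian_newtonFar8_scale ht y, mul_assoc])
  have h3 := Measure.integral_comp_smul (volume : Measure E8) (fun u : E8 => (Δ (newtonFar8 1)) u * φ (w + t • u)) t⁻¹
  simp only [finrank_euclideanSpace_fin, smul_eq_mul] at h3
  have h4 : (fun y : E8 => (Δ (newtonFar8 1)) (t⁻¹ • y) * φ (w + t • t⁻¹ • y)) =
      fun y => (Δ (newtonFar8 1)) (t⁻¹ • y) * φ (y + w) := by
    funext y
    rw [smul_smul, mul_inv_cancel₀ ht.ne', one_smul, add_comm]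
  rw [h4] at h3
  rw [h1, h2, integral_const_mul, h3, inv_pow, inv_inv, abs_of_pos (pow_pos ht 8), ← mul_assoc,
    inv_mul_cancel₀ (pow_ne_zero 8 ht.ne'), one_mul]

/-- **Uniform bound**: `|∫ Δf_t(z - w) φ(z) dz| ≤ M ∫|Δf₁|` if `|φ| ≤ M`. [folklore] -/
theorem abs_integral_laplacian_newtonFar8_sub_mul_le (ht : 0 < t) {φ : E8 → ℝ} {M : ℝ} (hφ : ∀ z, |φ z| ≤ M)
    (w : E8) : |∫ z, (Δ (newtonFar8 t)) (z - w) * φ z| ≤ M * ∫ u, |(Δ (newtonFar8 1)) u| := by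
  rw [integral_laplacian_newtonFar8_sub_mul ht]
  have hint : Integrable fun u : E8 => |(Δ (newtonFar8 1)) u| * M := ((integrable_laplacian_newtonFar8 one_pos).abs).mul_const M
  calc |∫ u, (Δ (newtonFar8 1)) u * φ (w + t • u)| ≤ ∫ u, |(Δ (newtonFar8 1)) u * φ (w + t • u)| :=
        abs_integral_le_integral_abs
    _ ≤ ∫ u, |(Δ (newtonFar8 1)) u| * M := by
        refine integral_mono_of_nonneg (Eventually.of_forall fun _ => abs_nonneg _) hint (Eventually.of_forall fun u => ?_)
        simp only
        rw [abs_mul]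
        exact mul_le_mul_of_nonneg_left (hφ _) (abs_nonneg _)
    _ = M * ∫ u, |(Δ (newtonFar8 1)) u| := by rw [integral_mul_const, mul_comm]

/-- **`Δf_t` is `-2π⁴` times an approximate identity**: for a bounded continuous `φ` and `tₙ → 0⁺`,
`∫ Δf_{tₙ}(z - w) φ(z) dz → -2π⁴ φ(w)` (`∫ Δf₁ = -2π⁴`; dominated convergence after the substitution
`z = w + tₙ u`). [cite: LiebLoss2001, Thm 2.16] -/
theorem tendsto_integral_laplacian_newtonFar8_mul {φ : E8 → ℝ} (hφc : Continuous φ) {M : ℝ} (hφ : ∀ z, |φ z| ≤ M)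
    {τ : ℕ → ℝ} (hτpos : ∀ n, 0 < τ n) (hτ : Tendsto τ atTop (𝓝 0)) (w : E8) :
    Tendsto (fun n => ∫ z, (Δ (newtonFar8 (τ n))) (z - w) * φ z) atTop (𝓝 (-(2 * Real.pi ^ 4) * φ w)) := by
  have hM : 0 ≤ M := (abs_nonneg _).trans (hφ 0)
  have hfun : ∀ n, ∫ z, (Δ (newtonFar8 (τ n))) (z - w) * φ z = ∫ u, (Δ (newtonFar8 1)) u * φ (w + τ n • u) :=
    fun n => integral_laplacian_newtonFar8_sub_mul (hτpos n) φ w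
  simp_rw [hfun]
  rw [← integral_laplacian_newtonFar8 one_pos, ← integral_mul_const]
  refine tendsto_integral_of_dominated_convergence (fun u => |(Δ (newtonFar8 1)) u| * M) (fun n => ?_) ?_ (fun n => ?_) ?_
  · have hc : Continuous fun u : E8 => w + τ n • u := continuous_const.add (continuous_id.const_smul (τ n))
    exact (continuous_laplacian_newtonFar8 one_pos).aestronglyMeasurable.mul (hφc.comp hc).aestronglyMeasurable
  · exact ((integrable_laplacian_newtonFar8 one_pos).abs).mul_const _
  · refine Eventually.of_forall fun u => ?_
    rw [Real.norm_eq_abs, abs_mul]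
    exact mul_le_mul_of_nonneg_left (hφ _) (abs_nonneg _)
  · refine Eventually.of_forall fun u => Tendsto.const_mul _ ?_
    have h : Tendsto (fun n => w + τ n • u) atTop (𝓝 (w + (0 : ℝ) • u)) :=
      tendsto_const_nhds.add (hτ.smul_const u)
    rw [zero_smul, add_zero] at h
    exact (hφc.tendsto w).comp h

end ApproxIdentity

end Summit.AtomisticToContinuum.Crystallization.Theorems.PricedLinkCensusLocalToGlobal

end
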